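import Mathlib
import HarnessLib
import Summits.QuantumFields.YangMills.Theses.LangevinControlUV
import Summits.QuantumFields.YangMills.Theorems.FemtoCurvatureSkewness.Negative.ZeroCoupling
import Summits.QuantumFields.YangMills.Theorems.FemtoCurvatureSkewness.Negative.WildUnitMap

/-!
# `FemtoCurvatureSkewness` — negative-side support: wild unit maps carry the two-point package;
the typed crux is false modulo (covariance uniformities ∧ zeros of `κ₃` at large coupling)

Support file for crux `stmt-QuantumFields-9365` (`LangevinControlUV.FemtoCurvatureSkewness`), written by the LEAD of
line `Sketch-ideator3` (prover-line-stmt-QuantumFields-9365-0, 2026-08-16) about the line's residual stub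
`PackagePinsScale` ("two unit maps carrying the two-point package are comparable"), which isolates the `∀ a` shell of
the typed crux.

* `twoPointPackage_wild` — if, above a coupling `βu`, the torus Wilson covariances of the plaquette field are
  UNIFORMLY COMPARABLE — (POS) `Cov_{L,β}(P_0^{01}, P_{ne₂}^{01}) > 0` for `L ≥ 8n`; (UNIF-L) `Cov_L ≤ K·Cov_{L'}` at
  equal `(β, n)`; (UNIF-B) `n⁸·Cov_L ≤ K`; (UNIF-B') `|Cov(P_x^{ij}, P_y^{i'j'})|·dist⁸ ≤ K`; (UNIF-O)
  `|Cov_L(pair at integer distance n)| ≤ K·Cov_{L'}(axis, n)` — then below EVERY positive `g → 0` there is a unit map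
  `a ≤ g` with `TwoPointPackage r a`: the wild map of `exists_wildMap` has singleton level sets, so ONE shape function
  `Γ` read off the covariances (`sup` over volumes on each level, `1` off the levels) satisfies both clauses with
  `c = 1`, `C = K²` — no multiscale content at all.  The typed hypothesis of the crux therefore does NOT pin the unit
  map to the physical scale.
* `exists_incomparable_packages` — hence two package maps `a`, `a' ≤ e^{-β}·a` exist: the residual stub
  `PackagePinsScale` of the line is false for `(G, r)` modulo the uniformities.
* `femtoCurvatureSkewness_iff` — the crux unbundled (definitional), for the negative lemma of the next file
  `Negative/FalseOfUniformZeros.lean` (`FemtoCurvatureSkewness_false_of_UniformZeros`: uniformities ∧ exact zeros of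
  `κ₃` along `β_k → ∞` ⇒ `¬ FemtoCurvatureSkewness`).
None of the uniformities is constructible in the tree today (weak-coupling / infrared control of 4-d Yang–Mills); the
statements record exactly what the typed `∀ a` crux bets against, for the planners' restatement (Memo R1).
-/

noncomputable section

namespace Summit.QuantumFields.YangMills.Theorems.FemtoCurvatureSkewness.Negative

open MeasureTheory Filter Topology Function
open Literature.MathematicalPhysics.QuantumFieldTheory
open Summit.QuantumFields.YangMills.Theses.LangevinControlUV (FemtoCurvatureSkewness)

section Wild

variable {G : Type} [Group G] [TopologicalSpace G] [IsTopologicalGroup G] [CompactSpace G]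
  [MeasurableSpace G] [BorelSpace G]

omit [TopologicalSpace G] [IsTopologicalGroup G] [CompactSpace G] [MeasurableSpace G] [BorelSpace G] in
/-- The squared torus distance is a natural number `m` with `torusDist = √m`, and `m ≥ 1` for distinct sites. -/
theorem torusDist_eq_sqrt_nat {L : ℕ} (x y : Site 4 L) (hxy : x ≠ y) :
    ∃ m : ℕ, 1 ≤ m ∧ torusDist L x y = Real.sqrt m := by
  classical
  refine ⟨∑ k : Fin 4, ((x k - y k).valMinAbs.natAbs) ^ 2, ?_, ?_⟩
  · obtain ⟨k, hk⟩ : ∃ k, x k ≠ y k := by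
      by_contra h
      push Not at h
      exact hxy (funext h)
    have hne : (x k - y k).valMinAbs ≠ 0 := by
      rw [Ne, ZMod.valMinAbs_eq_zero]
      exact sub_ne_zero.2 hk
    have h1 : 1 ≤ ((x k - y k).valMinAbs.natAbs) ^ 2 := by
      have : 1 ≤ (x k - y k).valMinAbs.natAbs := Int.natAbs_pos.2 hne
      nlinarith
    exact le_trans h1 (Finset.single_le_sum (f := fun i => ((x i - y i).valMinAbs.natAbs) ^ 2)
      (fun i _ => Nat.zero_le _) (Finset.mem_univ k))
  · unfold torusDist
    congr 1
    rw [Nat.cast_sum]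
    refine Finset.sum_congr rfl fun k _ => ?_
    simp only [Nat.cast_pow, Nat.cast_natAbs, Int.cast_abs, sq_abs]

/-- **A wild unit map carries the two-point package under uniform comparability of the covariances.**  If, above a
coupling `βu`, the torus Wilson covariances of the plaquette field satisfy (POS), (UNIF-L), (UNIF-B), (UNIF-B'), (UNIF-O)
(module docstring), then below every positive `g → 0` there is a unit map `a ≤ g` carrying `TwoPointPackage r a`
(`β₀ := βu`, `ℓ₀ := 1`, `c := 1`, `C := K²`; `Γ` := the volume-envelope of `n⁸Cov` on the singleton level sets of the
wild map of `exists_wildMap`, `1` elsewhere). -/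
theorem twoPointPackage_wild (r : LatticeRep G) {βu K : ℝ} (hK : 1 ≤ K)
    (hPOS : ∀ (L : ℕ) [NeZero L] (β : ℝ) (n : ℕ), βu ≤ β → 1 ≤ n → 8 * n ≤ L →
      0 < wCov r L β (plaq r L 0 0 1) (plaq r L (Pi.single (2 : Fin 4) ((n : ℕ) : ZMod L)) 0 1))
    (hUL : ∀ (L L' : ℕ) [NeZero L] [NeZero L'] (β : ℝ) (n : ℕ), βu ≤ β → 1 ≤ n → 8 * n ≤ L → 8 * n ≤ L' →
      wCov r L β (plaq r L 0 0 1) (plaq r L (Pi.single (2 : Fin 4) ((n : ℕ) : ZMod L)) 0 1) ≤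
        K * wCov r L' β (plaq r L' 0 0 1) (plaq r L' (Pi.single (2 : Fin 4) ((n : ℕ) : ZMod L')) 0 1))
    (hUB : ∀ (L : ℕ) [NeZero L] (β : ℝ) (n : ℕ), βu ≤ β → 1 ≤ n → 8 * n ≤ L →
      (n : ℝ) ^ 8 * wCov r L β (plaq r L 0 0 1) (plaq r L (Pi.single (2 : Fin 4) ((n : ℕ) : ZMod L)) 0 1) ≤ K)
    (hUB' : ∀ (L : ℕ) [NeZero L] (β : ℝ) (x y : Site 4 L) (i j i' j' : Fin 4), βu ≤ β → x ≠ y → i ≠ j →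
      i' ≠ j' → |wCov r L β (plaq r L x i j) (plaq r L y i' j')| * torusDist L x y ^ 8 ≤ K)
    (hUO : ∀ (L L' : ℕ) [NeZero L] [NeZero L'] (β : ℝ) (n : ℕ) (x y : Site 4 L) (i j i' j' : Fin 4),
      βu ≤ β → 1 ≤ n → 8 * n ≤ L' → x ≠ y → i ≠ j → i' ≠ j' → torusDist L x y = n →
      |wCov r L β (plaq r L x i j) (plaq r L y i' j')| ≤
        K * wCov r L' β (plaq r L' 0 0 1) (plaq r L' (Pi.single (2 : Fin 4) ((n : ℕ) : ZMod L')) 0 1))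
    (g : ℝ → ℝ) (hg : ∀ β, 0 < g β) (hg0 : Tendsto g atTop (𝓝 0)) :
    ∃ a : ℝ → ℝ, TwoPointPackage r a ∧ ∀ β, a β ≤ g β := by
  classical
  obtain ⟨a, ha, hag, huniq, hdist⟩ := exists_wildMap g hg
  have hK0 : 0 < K := lt_of_lt_of_le one_pos hK
  -- the set of normalised axis covariances over all volumes `L ≥ 8n`, at the level `(n, β)`
  let V : ℕ → ℝ → Set ℝ := fun n β =>
    {v | ∃ (L : ℕ) (_ : NeZero L), 8 * n ≤ L ∧
      v = (n : ℝ) ^ 8 * wCov r L β (plaq r L 0 0 1) (plaq r L (Pi.single (2 : Fin 4) ((n : ℕ) : ZMod L)) 0 1)}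
  have hVmem : ∀ (L : ℕ) [NeZero L] (n : ℕ) (β : ℝ), 8 * n ≤ L →
      (n : ℝ) ^ 8 * wCov r L β (plaq r L 0 0 1) (plaq r L (Pi.single (2 : Fin 4) ((n : ℕ) : ZMod L)) 0 1)
        ∈ V n β := fun L _ n β h8 => ⟨L, ‹_›, h8, rfl⟩
  have hVbdd : ∀ (n : ℕ) (β : ℝ), βu ≤ β → 1 ≤ n → BddAbove (V n β) := by
    intro n β hβ hn
    refine ⟨K, ?_⟩
    rintro v ⟨L, hL, h8, rfl⟩
    exact hUB L β n hβ hn h8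
  have hVne : ∀ (n : ℕ) (β : ℝ), 1 ≤ n → (V n β).Nonempty := by
    intro n β hn
    haveI : NeZero (8 * n) := ⟨by omega⟩
    exact ⟨_, hVmem (8 * n) n β le_rfl⟩
  -- envelope
  let S : ℕ → ℝ → ℝ := fun n β => sSup (V n β)
  have hS_le : ∀ (n : ℕ) (β : ℝ), βu ≤ β → 1 ≤ n → S n β ≤ K := by
    intro n β hβ hn
    refine csSup_le (hVne n β hn) ?_
    rintro v ⟨L, hL, h8, rfl⟩
    exact hUB L β n hβ hn h8
  have hle_S : ∀ (L : ℕ) [NeZero L] (n : ℕ) (β : ℝ), βu ≤ β → 1 ≤ n → 8 * n ≤ L →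
      (n : ℝ) ^ 8 * wCov r L β (plaq r L 0 0 1) (plaq r L (Pi.single (2 : Fin 4) ((n : ℕ) : ZMod L)) 0 1)
        ≤ S n β := fun L _ n β hβ hn h8 => le_csSup (hVbdd n β hβ hn) (hVmem L n β h8)
  have hS_pos : ∀ (n : ℕ) (β : ℝ), βu ≤ β → 1 ≤ n → 0 < S n β := by
    intro n β hβ hn
    haveI : NeZero (8 * n) := ⟨by omega⟩
    have h1 := hle_S (8 * n) n β hβ hn le_rfl
    have h2 : 0 < (n : ℝ) ^ 8 * wCov r (8 * n) β (plaq r (8 * n) 0 0 1)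
        (plaq r (8 * n) (Pi.single (2 : Fin 4) ((n : ℕ) : ZMod (8 * n))) 0 1) := by
      have hn' : (0 : ℝ) < n := by exact_mod_cast hn
      exact mul_pos (by positivity) (hPOS (8 * n) β n hβ hn le_rfl)
    linarith
  -- every volume value dominates the envelope up to `K` (volume comparability)
  have hS_le_K_mul : ∀ (L : ℕ) [NeZero L] (n : ℕ) (β : ℝ), βu ≤ β → 1 ≤ n → 8 * n ≤ L →
      S n β ≤ K * ((n : ℝ) ^ 8 *
        wCov r L β (plaq r L 0 0 1) (plaq r L (Pi.single (2 : Fin 4) ((n : ℕ) : ZMod L)) 0 1)) := by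
    intro L _ n β hβ hn h8
    refine csSup_le (hVne n β hn) ?_
    rintro v ⟨L', hL', h8', rfl⟩
    have := hUL L' L β n hβ hn h8' h8
    have hn8 : (0 : ℝ) ≤ (n : ℝ) ^ 8 := by positivity
    nlinarith [mul_le_mul_of_nonneg_left this hn8]
  -- the shape function: envelope on levels, 1 elsewhere
  let isLevel : ℝ → Prop := fun s => ∃ p : ℕ × ℝ, 1 ≤ p.1 ∧ βu ≤ p.2 ∧ s = (p.1 : ℝ) * a p.2
  let Γ : ℝ → ℝ := fun s => if h : isLevel s then S (Classical.choose h).1 (Classical.choose h).2 / K else 1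
  have hΓ_level : ∀ (n : ℕ) (β : ℝ), 1 ≤ n → βu ≤ β → Γ ((n : ℝ) * a β) = S n β / K := by
    intro n β hn hβ
    have h : isLevel ((n : ℝ) * a β) := ⟨(n, β), hn, hβ, rfl⟩
    have hdef : Γ ((n : ℝ) * a β) = S (Classical.choose h).1 (Classical.choose h).2 / K := dif_pos h
    obtain ⟨hp1, -, hp3⟩ := Classical.choose_spec h
    obtain ⟨hβeq, hneq⟩ := huniq β (Classical.choose h).2 n (Classical.choose h).1 hn hp1 hp3
    have e1 : (Classical.choose h).1 = n := hneq.symm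
    have e2 : (Classical.choose h).2 = β := hβeq.symm
    simp only [hdef, e1, e2]
  have hΓ_nonlevel : ∀ s, ¬ isLevel s → Γ s = 1 := fun s h => dif_neg h
  have hΓ_bounds : ∀ s, 0 < Γ s ∧ Γ s ≤ 1 := by
    intro s
    by_cases h : isLevel s
    · obtain ⟨p, hp1, hp2, rfl⟩ := h
      rw [hΓ_level p.1 p.2 hp1 hp2]
      exact ⟨div_pos (hS_pos p.1 p.2 hp2 hp1) hK0, (div_le_one hK0).2 (hS_le p.1 p.2 hp2 hp1)⟩
    · exact (hΓ_nonlevel s h).symm ▸ ⟨one_pos, le_rfl⟩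
  -- the package
  refine ⟨a, ⟨Γ, βu, 1, 1, K ^ 2, one_pos, one_pos, ha, ?_, fun s _ _ => hΓ_bounds s, ?_⟩, hag⟩
  · exact tendsto_of_tendsto_of_tendsto_of_le_of_le tendsto_const_nhds hg0 (fun β => (ha β).le) hag
  · intro L _ β hβ _hL
    refine ⟨fun n hn h8 => ?_, fun x y i j i' j' hxy hij hi'j' => ?_⟩
    · -- axis clause on the level `(n, β)`
      rw [hΓ_level n β hn hβ, one_mul]
      refine ⟨?_, ?_⟩
      · rw [div_le_iff₀ hK0]
        have := hS_le_K_mul L n β hβ hn h8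
        linarith
      · have h1 := hle_S L n β hβ hn h8
        have h2 : S n β ≤ K ^ 2 * (S n β / K) := by
          rw [show K ^ 2 * (S n β / K) = K * S n β by field_simp]
          have := hS_pos n β hβ hn
          nlinarith
        linarith
    · -- all-pairs clause
      obtain ⟨m, hm, hdm⟩ := torusDist_eq_sqrt_nat x y hxy
      by_cases h : isLevel (torusDist L x y * a β)
      · obtain ⟨p, hp1, hp2, hp3⟩ := h
        rw [hdm] at hp3
        obtain ⟨hβeq, hsq⟩ := hdist β p.2 m p.1 hm hp1 hp3
        -- the distance is the natural number `p.1`, at the same coupling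
        have hdn : torusDist L x y = (p.1 : ℝ) := by rw [hdm, hsq]
        rw [hdn, hΓ_level p.1 β hp1 hβ]
        haveI : NeZero (8 * p.1) := ⟨by omega⟩
        have hO := hUO L (8 * p.1) β p.1 x y i j i' j' hβ hp1 le_rfl hxy hij hi'j' hdn
        have hS := hle_S (8 * p.1) p.1 β hβ hp1 le_rfl
        have hp8 : (0 : ℝ) ≤ (p.1 : ℝ) ^ 8 := by positivity
        calc |wCov r L β (plaq r L x i j) (plaq r L y i' j')| * (p.1 : ℝ) ^ 8
            ≤ K * wCov r (8 * p.1) β (plaq r (8 * p.1) 0 0 1)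
                (plaq r (8 * p.1) (Pi.single (2 : Fin 4) ((p.1 : ℕ) : ZMod (8 * p.1))) 0 1) * (p.1 : ℝ) ^ 8 :=
              mul_le_mul_of_nonneg_right hO hp8
          _ = K * ((p.1 : ℝ) ^ 8 * wCov r (8 * p.1) β (plaq r (8 * p.1) 0 0 1)
                (plaq r (8 * p.1) (Pi.single (2 : Fin 4) ((p.1 : ℕ) : ZMod (8 * p.1))) 0 1)) := by ring
          _ ≤ K * S p.1 β := mul_le_mul_of_nonneg_left hS hK0.le
          _ = K ^ 2 * (S p.1 β / K) := by field_simp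
      · rw [hΓ_nonlevel _ h, mul_one]
        have h1 := hUB' L β x y i j i' j' hβ hxy hij hi'j'
        nlinarith

/-- **Two package maps need not be comparable** (under the uniformities): below `e^{-β}` there is a package map `a`,
and below `e^{-β}·a` another one `a'`; then `a'/a → 0`, so no `ε > 0` has `ε·a ≤ a'` eventually.  This is the
negation of the line's residual stub `PackagePinsScale` for `(G, r)`, modulo the uniformities. -/
theorem exists_incomparable_packages (r : LatticeRep G) {βu K : ℝ} (hK : 1 ≤ K)
    (hPOS : ∀ (L : ℕ) [NeZero L] (β : ℝ) (n : ℕ), βu ≤ β → 1 ≤ n → 8 * n ≤ L →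
      0 < wCov r L β (plaq r L 0 0 1) (plaq r L (Pi.single (2 : Fin 4) ((n : ℕ) : ZMod L)) 0 1))
    (hUL : ∀ (L L' : ℕ) [NeZero L] [NeZero L'] (β : ℝ) (n : ℕ), βu ≤ β → 1 ≤ n → 8 * n ≤ L → 8 * n ≤ L' →
      wCov r L β (plaq r L 0 0 1) (plaq r L (Pi.single (2 : Fin 4) ((n : ℕ) : ZMod L)) 0 1) ≤
        K * wCov r L' β (plaq r L' 0 0 1) (plaq r L' (Pi.single (2 : Fin 4) ((n : ℕ) : ZMod L')) 0 1))
    (hUB : ∀ (L : ℕ) [NeZero L] (β : ℝ) (n : ℕ), βu ≤ β → 1 ≤ n → 8 * n ≤ L →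
      (n : ℝ) ^ 8 * wCov r L β (plaq r L 0 0 1) (plaq r L (Pi.single (2 : Fin 4) ((n : ℕ) : ZMod L)) 0 1) ≤ K)
    (hUB' : ∀ (L : ℕ) [NeZero L] (β : ℝ) (x y : Site 4 L) (i j i' j' : Fin 4), βu ≤ β → x ≠ y → i ≠ j →
      i' ≠ j' → |wCov r L β (plaq r L x i j) (plaq r L y i' j')| * torusDist L x y ^ 8 ≤ K)
    (hUO : ∀ (L L' : ℕ) [NeZero L] [NeZero L'] (β : ℝ) (n : ℕ) (x y : Site 4 L) (i j i' j' : Fin 4),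
      βu ≤ β → 1 ≤ n → 8 * n ≤ L' → x ≠ y → i ≠ j → i' ≠ j' → torusDist L x y = n →
      |wCov r L β (plaq r L x i j) (plaq r L y i' j')| ≤
        K * wCov r L' β (plaq r L' 0 0 1) (plaq r L' (Pi.single (2 : Fin 4) ((n : ℕ) : ZMod L')) 0 1)) :
    ∃ a a' : ℝ → ℝ, TwoPointPackage r a ∧ TwoPointPackage r a' ∧
      ∀ ε : ℝ, 0 < ε → ∀ β₂ : ℝ, ∃ β : ℝ, β₂ ≤ β ∧ a' β < ε * a β := by
  obtain ⟨a, hPa, hag⟩ := twoPointPackage_wild r hK hPOS hUL hUB hUB' hUO (fun β => Real.exp (-β))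
    (fun β => Real.exp_pos _) Real.tendsto_exp_neg_atTop_nhds_zero
  obtain ⟨Γ, β₀, ℓ₀, c, C, -, -, ha, ha0, -⟩ := id hPa
  have hg' : ∀ β, 0 < Real.exp (-β) * a β := fun β => mul_pos (Real.exp_pos _) (ha β)
  have hg'0 : Tendsto (fun β => Real.exp (-β) * a β) atTop (𝓝 0) := by
    simpa using Real.tendsto_exp_neg_atTop_nhds_zero.mul ha0
  obtain ⟨a', hPa', ha'g⟩ := twoPointPackage_wild r hK hPOS hUL hUB hUB' hUO (fun β => Real.exp (-β) * a β)
    hg' hg'0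
  refine ⟨a, a', hPa, hPa', fun ε hε β₂ => ⟨max β₂ (1 - Real.log ε), le_max_left _ _, ?_⟩⟩
  set β := max β₂ (1 - Real.log ε) with hβdef
  have h1 : Real.exp (-β) < ε := by
    have : -β ≤ Real.log ε - 1 := by have := le_max_right β₂ (1 - Real.log ε); linarith
    calc Real.exp (-β) ≤ Real.exp (Real.log ε - 1) := Real.exp_le_exp.2 this
      _ < Real.exp (Real.log ε) := Real.exp_lt_exp.2 (by linarith)
      _ = ε := Real.exp_log hε
  calc a' β ≤ Real.exp (-β) * a β := ha'g β
    _ < ε * a β := mul_lt_mul_of_pos_right h1 (ha β)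

end Wild

/-- The crux, unbundled (definitional). -/
theorem femtoCurvatureSkewness_iff : FemtoCurvatureSkewness ↔
    ∀ (G : Type) [Group G] [TopologicalSpace G] [IsTopologicalGroup G] [CompactSpace G],
      IsCompactSimpleLieGroup G →
        letI : MeasurableSpace G := borel G
        haveI : BorelSpace G := ⟨rfl⟩
        ∀ (r : LatticeRep G) (a : ℝ → ℝ), TwoPointPackage r a → SkewnessPackage r a :=
  Iff.rfl

end Summit.QuantumFields.YangMills.Theorems.FemtoCurvatureSkewness.Negative

end
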